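/-
Copyright (c) 2026. All rights reserved.
Released under Apache 2.0 license as described in the file LICENSE.
-/
import Literature.AlgebraicGeometry.Pohlmann1968.DegenerateCMTypesAbelianCMFieldCyclicSubfields
import Literature.AlgebraicGeometry.Pohlmann1968.MultiquadraticCMFieldNearBentTypes
import HarnessLib

/-!
# The Walsh values of a CM type of a multiquadratic CM field are the multiplicity excesses over its imaginary
# quadratic subfields: `Ŝ_Φ(χ_F) = m_F(Φ) − m̄_F(Φ) = 2m_F(Φ) − g`; bent, near-bent and plateaued CM types read on
# the imaginary quadratic subfields (Dodson's weights, Kubota's characters)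

SETTING (tree `DegenerateCMTypesAbelianCMFieldCyclicSubfields`, `DegenerateCMTypesMultiquadraticCMField`,
`MultiquadraticCMFieldNearBentTypes`).  `K` a CM field, Galois over `ℚ` with `Gal(K/ℚ)` of exponent `2`
(`K = ℚ(√−d, √a₁, …, √a_r)`, `[K:ℚ] = 2g`), `ρ` = complex conjugation, `φ₀ : K → ℂ` a base embedding, `σ_s = φ₀ ∘ s⁻¹`,
`T_Φ = {s : σ_s ∈ Φ}` the group-level type of a CM type `Φ` (`|T_Φ| = g`), `Ŝ_Φ(χ) = Σ_{s ∈ T_Φ} χ(s)` the Walsh value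
at an odd character `χ` (`χ(ρ) = −1`).  For an IMAGINARY QUADRATIC subfield `F ⊆ K` (`[F:ℚ] = 2`, `F` not totally
real) and an embedding `τ : F → ℂ` put `m_τ(Φ) = #{φ ∈ Φ : φ|_F = τ}` (the multiplicity of `Φ` over `τ`, the weight
`(m_τ, m_τ̄)` of the action of `F`; `m_τ + m_τ̄ = g`).  The tree knows the `Ŝ = 0` slice of the dictionary below:
«`Φ` balanced over `F` ⟺ the sign character of `Gal(K/F)` vanishes on `T_Φ`» (`card_filter_mem_eq_iff_balanced`) and
the rank formula `Rank(Φ) + #{F imaginary quadratic : Φ balanced over F} = g + 1` (`cmTypeRank_add_ncard_weilQuadratic_eq`).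

THE PRINT.  B. Dodson [Dodson1984] §3.1.1 THEOREM (constant-weight criterion for `K = ℚ(√−d, √a₁, …)`: the CM types
as Boolean functions `f`, «`t(Φ) = r + 1`, unless the weight of `f` is `n/2`»; the weight of `f` over the quadratic
subfield is the multiplicity `m_τ`); T. Kubota [Kubota1965] §4 Lemma 2 (the characters `ψ` with `ψ(ρ) = −1` and the
sums `Σᵢ ψ(σᵢ)`); H. L. Montgomery–R. C. Vaughan [MontgomeryVaughan2007] §4.2 Lemma 4.2 (a character with kernel of
index `2` is the sign character: `Σ_{s∈S} χ(s) = #(S ∩ H) − #(S ∖ H)`, tree `sum_char_eq_card_sub_card_of_index_two`);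
C. Carlet [Carlet2020] §6.1.2 (bent: `W_f(u)² = 2ⁿ`), §6.2.4 (near-bent / semi-bent: `W_f ∈ {0, ±2^{(n+1)/2}}`), §6.2.1
Def. 63 (plateaued); G. Shimura [Shimura1998] §8.4 Example (1) (the multiplicities `(r_τ, s_τ)` of a CM type over a
subfield).  THIS FILE proves THE DICTIONARY and its instances:

> **Theorem** (`forall_odd_iff_forall_indexTwo`, group level; any finite commutative group of exponent `2`).  For a
> predicate `P` on `ℂ` and `T ⊆ G`: `P(Ŝ_T(χ))` holds for every odd character `χ` iff `P(#(T ∩ H) − #(T ∖ H))` holds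
> for every subgroup `H ∌ ρ` of index `2` (odd characters ↔ their kernels, the hyperplanes avoiding `ρ`;
> `exists_ker_of_apply_eq_neg_one`).
> **Theorem** (`forall_odd_iff_forall_quadratic`, THE DICTIONARY).  For a CM type `Φ` of a multiquadratic CM field and
> any predicate `P`: **`P(Ŝ_Φ(χ))` for every odd `χ` ⟺ `P(m_{φ₀|F}(Φ) − m_{φ̄₀|F}(Φ))` for every imaginary quadratic
> subfield `F ⊆ K`** (`Gal(K/F)` is the kernel; `card_filter_mem_fixingSubgroup_eq_ncard`,
> `card_filter_not_mem_fixingSubgroup_eq_ncard`: `#(T_Φ ∩ Gal(K/F)) = m_{φ₀|F}`, `#(T_Φ ∖ Gal(K/F)) = m_{φ̄₀|F}`), and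
> `m_τ + m_τ̄ = g` (`ncard_add_ncard_conjugate_eq`), every `τ : F → ℂ` being `φ₀|_F` or its conjugate.
> **Corollaries** (base-embedding-free).  `forall_sq_eq_iff_forall_quadratic`: **`Φ` is BENT (`Ŝ_Φ(χ)² = g` for all odd
> `χ`) iff `(2m_τ(Φ) − g)² = g` for every imaginary quadratic `F ⊆ K` and every `τ : F → ℂ`** — degree `32`
> (`g = 16`): iff `m_τ ∈ {6, 10}` over every one of the `16` imaginary quadratic subfields
> (`forall_sq_eq_iff_of_finrank_eq_thirtyTwo`); `nearBent_iff_forall_quadratic`: **near-bent iff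
> `m_τ ∈ {g/2, (g ± √(2g))/2}`** — degree `64`: iff `m_τ ∈ {12, 16, 20}` over every one of the `32` imaginary quadratic
> subfields (`nearBent_iff_of_finrank_eq_sixtyFour`), degree `16`: `m_τ ∈ {2, 4, 6}`; `plateaued_iff_forall_quadratic`.

HONEST SCOPE.  Dodson and Kubota print the weight/character bookkeeping for these fields; Carlet prints bent /
semi-bent / plateaued for Boolean functions; the sentence «Walsh value = multiplicity excess over the imaginary
quadratic subfield cut out by the kernel» is this file's reading joining the tree's `sum_char_eq_card_sub_card_of_index_two`
with its Galois-correspondence lemmas.  THEOREMS ONLY: no definition, no named fact, no instance, no `sorry`.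

## References

* [Dodson1984] B. Dodson, *The structure of Galois groups of CM-fields*, Trans. AMS 283 (1984), §3.1.1 Theorem.
* [Kubota1965] T. Kubota, *On the field extension by complex multiplication*, Trans. AMS 118 (1965), §4 Lemma 2.
* [MontgomeryVaughan2007] H. L. Montgomery, R. C. Vaughan, *Multiplicative Number Theory I*, CUP (2007), §4.2 Lemma 4.2.
* [Carlet2020] C. Carlet, *Boolean Functions for Cryptography and Coding Theory*, CUP (2020), §6.1.2, §6.2.1 Def. 63,
  §6.2.4.
* [Shimura1998] G. Shimura, *Abelian Varieties with Complex Multiplication and Modular Functions*, §8.4 Example (1),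
  §18.2 Lemma (i).
* [MilneFT2022] J. S. Milne, *Fields and Galois Theory*, Thm. 3.16, Prop. 2.7 (a) (extension of embeddings).

## Provenance

Lane `lit-hodgefound` (Track 2, Layer A3/A5 field dress), seat `lit-hodgefound-p10` generation 45, row g45-#4; gen-43
successor menu (c) / gen-44 (d) «imaginary-quadratic dictionary for Ŝ(χ), bentness».  Neighbours cited by name,
nothing restated: `CyclicCMType.AbelianKernels` (`sum_char_eq_card_sub_card_of_index_two`, `exists_oddChar_ker`, USED),
`Pohlmann1968.AbelianKernels` (`mem_fixingSubgroup_iff_embOf_comp_eq`, `not_mem_fixingSubgroup_iff_embOf_comp_eq_conjugate`,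
`index_eq_finrank_fixedField`, `conjGal_not_mem_iff_not_isTotallyReal_fixedField`, USED), `CMNumbers`
(`index_fixingSubgroup_eq_two`, `conjGal_not_mem_fixingSubgroup_iff`), `CMTypeElementaryTwoGroupOddWeights`
(`character_apply_eq_one_or_of_mul_self`), `CMTypeRankCharactersNumberField` (`embOf`, `embOf_bijective`),
`MultiquadraticCMFieldRankFiveTypesHodgeConjecture` (`Multiquadratic.isAbelianGalois_of_forall_sq_eq_one`), Mathlib
`NumberField.ComplexEmbedding.lift`.
-/

open scoped BigOperators NumberField IsMulCommutative Classical
open NumberField Module IntermediateField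

namespace Literature.AlgebraicGeometry.Pohlmann1968

namespace MultiquadraticWalshQuadratic

open scoped Literature.NumberTheory.ComplexMultiplication
open Literature.NumberTheory.ComplexMultiplication (IsCMTypeWith conjGal character_apply_eq_one_or_of_mul_self)
open Literature.NumberTheory.ComplexMultiplication.CMNumbers (index_fixingSubgroup_eq_two conjGal_not_mem_fixingSubgroup_iff)
open Literature.NumberTheory.ComplexMultiplication.CyclicCMType.AbelianKernels (sum_char_eq_card_sub_card_of_index_two
  exists_oddChar_ker)
open Literature.AlgebraicGeometry.Pohlmann1968.AbelianKernels (mem_fixingSubgroup_iff_embOf_comp_eq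
  not_mem_fixingSubgroup_iff_embOf_comp_eq_conjugate index_eq_finrank_fixedField
  conjGal_not_mem_iff_not_isTotallyReal_fixedField)
open Literature.AlgebraicGeometry.Motives (CMType)

/-! ## §1 Group level: odd characters ↔ hyperplanes avoiding `ρ` -/

section Group

variable {G : Type*} [CommGroup G] [Fintype G] {ρ : G}

omit [Fintype G] in
/-- `g·g = 1` in exponent `2`. [folklore] -/
private theorem mul_self_wq (hexp : ∀ g : G, g ^ 2 = 1) (g : G) : g * g = 1 := by
  rw [← pow_two]; exact hexp g

omit [Fintype G] in
/-- **THE KERNEL OF AN ODD CHARACTER IS A HYPERPLANE AVOIDING `ρ`**: for `χ(ρ) = −1` on a group of exponent `2`,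
`H = ker χ` is a subgroup of index `2` with `ρ ∉ H` (the values of `χ` are `±1`, `χ(gρ) = −χ(g)`).
[cite: MontgomeryVaughan2007, §4.2 Lemma 4.2 (p. 115)] [cite: Kubota1965, §4 Lemma 2] -/
theorem exists_ker_of_apply_eq_neg_one (hexp : ∀ g : G, g ^ 2 = 1) {χ : AddChar (Additive G) ℂ}
    (hχ : χ (Additive.ofMul ρ) = -1) :
    ∃ H : Subgroup G, ρ ∉ H ∧ H.index = 2 ∧ ∀ g : G, χ (Additive.ofMul g) = 1 ↔ g ∈ H := by
  let H : Subgroup G :=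
    { carrier := {g : G | χ (Additive.ofMul g) = 1}
      one_mem' := by
        show χ (Additive.ofMul (1 : G)) = 1
        rw [ofMul_one, AddChar.map_zero_eq_one]
      mul_mem' := fun {a b} ha hb => by
        show χ (Additive.ofMul (a * b)) = 1
        have ha' : χ (Additive.ofMul a) = 1 := ha
        have hb' : χ (Additive.ofMul b) = 1 := hb
        rw [ofMul_mul, AddChar.map_add_eq_mul, ha', hb', one_mul]
      inv_mem' := fun {a} ha => by
        show χ (Additive.ofMul a⁻¹) = 1
        rwa [inv_eq_of_mul_eq_one_right (mul_self_wq hexp a)] }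
  have hmem : ∀ g : G, g ∈ H ↔ χ (Additive.ofMul g) = 1 := fun g => Iff.rfl
  have hρH : ρ ∉ H := fun h => by
    have h1 := (hmem ρ).1 h
    rw [hχ] at h1
    norm_num at h1
  refine ⟨H, hρH, ?_, fun g => (hmem g).symm⟩
  rw [Subgroup.index_eq_two_iff]
  refine ⟨ρ, fun b => ?_⟩
  rw [hmem, hmem, ofMul_mul, AddChar.map_add_eq_mul, hχ, mul_neg_one, neg_eq_iff_eq_neg, xor_def]
  rcases character_apply_eq_one_or_of_mul_self χ (mul_self_wq hexp b) with h1 | h1 <;> rw [h1] <;> norm_num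

omit [Fintype G] in
/-- `G/H` is cyclic for `H` of index `2`. [folklore] -/
private theorem isCyclic_quotient_wq {H : Subgroup G} (hidx : H.index = 2) : IsCyclic (G ⧸ H) := by
  haveI : Fact (Nat.Prime 2) := ⟨Nat.prime_two⟩
  exact isCyclic_of_prime_card (p := 2) (by rw [← Subgroup.index_eq_card, hidx])

/-- **ODD CHARACTERS ↔ HYPERPLANES AVOIDING `ρ` (group level).**  On a finite commutative group of exponent `2`, for any
predicate `P` and any `T ⊆ G`: `P(Ŝ_T(χ))` holds for every odd character `χ` iff `P(#(T ∩ H) − #(T ∖ H))` holds for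
every subgroup `H ∌ ρ` of index `2` — each odd `χ` is the sign character of its kernel, each such `H` is the kernel of an
odd `χ`. [cite: MontgomeryVaughan2007, §4.2 Lemma 4.2 (p. 115)] [cite: Kubota1965, §4 Lemma 2] -/
theorem forall_odd_iff_forall_indexTwo (hexp : ∀ g : G, g ^ 2 = 1) (T : Finset G) (P : ℂ → Prop) :
    (∀ χ : AddChar (Additive G) ℂ, χ (Additive.ofMul ρ) = -1 → P (∑ t ∈ T, χ (Additive.ofMul t))) ↔
      ∀ H : Subgroup G, ρ ∉ H → H.index = 2 →
        P (((T.filter fun t => t ∈ H).card : ℂ) - ((T.filter fun t => t ∉ H).card : ℂ)) := by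
  constructor
  · intro h H hρH hidx
    obtain ⟨χ, hχ, hker⟩ := exists_oddChar_ker hρH (mul_self_wq hexp ρ) (isCyclic_quotient_wq hidx)
    rw [← sum_char_eq_card_sub_card_of_index_two χ hker hidx T]
    exact h χ hχ
  · intro h χ hχ
    obtain ⟨H, hρH, hidx, hker⟩ := exists_ker_of_apply_eq_neg_one hexp hχ
    rw [sum_char_eq_card_sub_card_of_index_two χ hker hidx T]
    exact h H hρH hidx

end Group

/-! ## §2 Field level: the hyperplanes avoiding `ρ` are the `Gal(K/F)`, `F` imaginary quadratic -/

section Field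

variable {K : Type} [Field K] [NumberField K] [IsCMField K] [IsGalois ℚ K]

omit [IsCMField K] [IsGalois ℚ K] in
/-- The multiplicity of `Φ` over an embedding `τ` of `F`, counted on `Gal(K/ℚ)` through `s ↦ σ_s`:
`#{s ∈ T_Φ : σ_s|_F = τ} = #{φ ∈ Φ : φ|_F = τ}`. [cite: Shimura1998, §8.4 Example (1)] -/
private theorem card_filter_embOf_comp_eq_wq [Normal ℚ K] (φ₀ : K →+* ℂ) (Φ : CMType K)
    (F : IntermediateField ℚ K) (τ : F →+* ℂ) :
    ((Finset.univ.filter fun s : K ≃ₐ[ℚ] K => embOf φ₀ s ∈ Φ.1).filter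
        fun s => (embOf φ₀ s).comp (algebraMap F K) = τ).card =
      {φ : K →+* ℂ | φ.comp (algebraMap F K) = τ ∧ φ ∈ Φ.1}.ncard := by
  have h1 : {φ : K →+* ℂ | φ.comp (algebraMap F K) = τ ∧ φ ∈ Φ.1} =
      ↑(Finset.univ.filter fun φ : K →+* ℂ => φ.comp (algebraMap F K) = τ ∧ φ ∈ Φ.1) := by
    ext φ; simp
  rw [h1, Set.ncard_coe_finset]
  have h2 : (Finset.univ.filter fun φ : K →+* ℂ => φ.comp (algebraMap F K) = τ ∧ φ ∈ Φ.1) =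
      (((Finset.univ.filter fun s : K ≃ₐ[ℚ] K => embOf φ₀ s ∈ Φ.1).filter
        fun s => (embOf φ₀ s).comp (algebraMap F K) = τ)).image (embOf φ₀) := by
    ext φ
    simp only [Finset.mem_filter, Finset.mem_univ, true_and, Finset.mem_image]
    constructor
    · rintro ⟨hφ, hφΦ⟩
      obtain ⟨s, rfl⟩ := (embOf_bijective φ₀).2 φ
      exact ⟨s, ⟨hφΦ, hφ⟩, rfl⟩
    · rintro ⟨s, ⟨hs, hres⟩, rfl⟩
      exact ⟨hres, hs⟩
  rw [h2, Finset.card_image_of_injective _ (embOf_bijective φ₀).1]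

omit [IsCMField K] in
/-- **`#(T_Φ ∩ Gal(K/F)) = m_{φ₀|F}(Φ)`**: the elements of the group-level type lying in `Gal(K/F)` are counted by the
embeddings `φ ∈ Φ` extending `φ₀|_F` (`s ∈ Gal(K/F) ⟺ σ_s|_F = φ₀|_F`). [cite: Dodson1984, §3.1.1 Theorem (proof)]
[cite: Shimura1998, §8.4 Example (1)] -/
theorem card_filter_mem_fixingSubgroup_eq_ncard (φ₀ : K →+* ℂ) (Φ : CMType K) (F : IntermediateField ℚ K) :
    ((Finset.univ.filter fun s : K ≃ₐ[ℚ] K => embOf φ₀ s ∈ Φ.1).filter fun s => s ∈ F.fixingSubgroup).card =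
      {φ : K →+* ℂ | φ.comp (algebraMap F K) = φ₀.comp (algebraMap F K) ∧ φ ∈ Φ.1}.ncard := by
  rw [← card_filter_embOf_comp_eq_wq φ₀ Φ F]
  congr 1
  exact Finset.filter_congr fun s _ => mem_fixingSubgroup_iff_embOf_comp_eq φ₀ F s

/-- **`#(T_Φ ∖ Gal(K/F)) = m_{φ̄₀|F}(Φ)`** for an imaginary quadratic subfield `F` (`s ∉ Gal(K/F) ⟺ σ_s|_F = conj ∘ φ₀|_F`).
[cite: Dodson1984, §3.1.1 Theorem (proof)] [cite: Shimura1998, §8.4 Example (1) and §18.2 Lemma (i)] -/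
theorem card_filter_not_mem_fixingSubgroup_eq_ncard (hexp : ∀ g : K ≃ₐ[ℚ] K, g ^ 2 = 1) (φ₀ : K →+* ℂ)
    (Φ : CMType K) (F : IntermediateField ℚ K) (h2 : finrank ℚ F = 2) (hF : ¬ IsTotallyReal F) :
    ((Finset.univ.filter fun s : K ≃ₐ[ℚ] K => embOf φ₀ s ∈ Φ.1).filter fun s => s ∉ F.fixingSubgroup).card =
      {φ : K →+* ℂ | φ.comp (algebraMap F K) = ComplexEmbedding.conjugate (φ₀.comp (algebraMap F K)) ∧
        φ ∈ Φ.1}.ncard := by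
  haveI := Multiquadratic.isAbelianGalois_of_forall_sq_eq_one hexp
  rw [← card_filter_embOf_comp_eq_wq φ₀ Φ F]
  congr 1
  exact Finset.filter_congr fun s _ => not_mem_fixingSubgroup_iff_embOf_comp_eq_conjugate φ₀ F h2 hF s

omit [IsCMField K] in
/-- `|T_Φ| = g = [K:ℚ]/2`. [cite: Shimura1998, §8.1] -/
private theorem card_T_eq_wq (φ₀ : K →+* ℂ) (Φ : CMType K) :
    (Finset.univ.filter fun s : K ≃ₐ[ℚ] K => embOf φ₀ s ∈ Φ.1).card = finrank ℚ K / 2 := by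
  have h := Literature.AlgebraicGeometry.Motives.HodgeStructure.two_mul_ncard_cmType_eq_finrank Φ
  rw [← Set.ncard_coe_finset]
  have himg : (embOf φ₀) '' (↑(Finset.univ.filter fun s : K ≃ₐ[ℚ] K => embOf φ₀ s ∈ Φ.1) : Set (K ≃ₐ[ℚ] K)) =
      Φ.1 := by
    ext φ
    simp only [Set.mem_image, Finset.coe_filter, Finset.mem_univ, true_and, Set.mem_setOf_eq]
    constructor
    · rintro ⟨s, hs, rfl⟩
      exact hs
    · intro hφ
      obtain ⟨s, rfl⟩ := (embOf_bijective φ₀).2 φ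
      exact ⟨s, hφ, rfl⟩
  have h2 := Set.ncard_image_of_injective
    (↑(Finset.univ.filter fun s : K ≃ₐ[ℚ] K => embOf φ₀ s ∈ Φ.1) : Set (K ≃ₐ[ℚ] K)) (embOf_bijective φ₀).1
  rw [himg] at h2
  rw [← h2]
  omega

/-- **`m_τ(Φ) + m_τ̄(Φ) = g`**: over an imaginary quadratic subfield every `φ ∈ Φ` extends `φ₀|_F` or its conjugate,
so the two multiplicities add up to `|Φ| = [K:ℚ]/2` (the weight `(m_τ, g − m_τ)` of `F` on `Φ`).
[cite: Shimura1998, §8.4 Example (1)] [cite: Dodson1984, §3.1.1 Theorem] -/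
theorem ncard_add_ncard_conjugate_eq (hexp : ∀ g : K ≃ₐ[ℚ] K, g ^ 2 = 1) (φ₀ : K →+* ℂ) (Φ : CMType K)
    (F : IntermediateField ℚ K) (h2 : finrank ℚ F = 2) (hF : ¬ IsTotallyReal F) :
    {φ : K →+* ℂ | φ.comp (algebraMap F K) = φ₀.comp (algebraMap F K) ∧ φ ∈ Φ.1}.ncard +
      {φ : K →+* ℂ | φ.comp (algebraMap F K) = ComplexEmbedding.conjugate (φ₀.comp (algebraMap F K)) ∧
        φ ∈ Φ.1}.ncard = finrank ℚ K / 2 := by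
  rw [← card_filter_mem_fixingSubgroup_eq_ncard φ₀ Φ F,
    ← card_filter_not_mem_fixingSubgroup_eq_ncard hexp φ₀ Φ F h2 hF, Finset.card_filter_add_card_filter_not,
    card_T_eq_wq]

/-- Every embedding of an imaginary quadratic subfield `F ⊆ K` is `φ₀|_F` or its conjugate (here from the fibre
dictionary; the abstract statement for any imaginary quadratic field is the tree's
`QuarticCM.eq_or_eq_conjugate_of_finrank_eq_two`). [cite: Shimura1998, §8.4 (2), §18.2 Lemma (i)] -/
private theorem eq_or_eq_conjugate_wq (hexp : ∀ g : K ≃ₐ[ℚ] K, g ^ 2 = 1) (φ₀ : K →+* ℂ)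
    (F : IntermediateField ℚ K) (h2 : finrank ℚ F = 2) (hF : ¬ IsTotallyReal F) (τ : F →+* ℂ) :
    τ = φ₀.comp (algebraMap F K) ∨ τ = ComplexEmbedding.conjugate (φ₀.comp (algebraMap F K)) := by
  haveI := Multiquadratic.isAbelianGalois_of_forall_sq_eq_one hexp
  obtain ⟨φ, hφ⟩ : ∃ φ : K →+* ℂ, φ.comp (algebraMap F K) = τ :=
    ⟨ComplexEmbedding.lift K τ, ComplexEmbedding.lift_comp_algebraMap K τ⟩
  obtain ⟨s, rfl⟩ := (embOf_bijective φ₀).2 φ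
  by_cases hs : s ∈ F.fixingSubgroup
  · left; rw [← hφ]; exact (mem_fixingSubgroup_iff_embOf_comp_eq φ₀ F s).1 hs
  · right; rw [← hφ]; exact (not_mem_fixingSubgroup_iff_embOf_comp_eq_conjugate φ₀ F h2 hF s).1 hs

/-- **THE DICTIONARY.**  For a CM type `Φ` of a multiquadratic CM field and any predicate `P`: **`P(Ŝ_Φ(χ))` holds
for every odd character `χ` of `Gal(K/ℚ)` iff `P(m_{φ₀|F}(Φ) − m_{φ̄₀|F}(Φ))` holds for every imaginary quadratic
subfield `F ⊆ K`** — the Walsh value at the sign character of `Gal(K/F)` is the excess of the embeddings of `Φ` over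
`φ₀|_F` over those over its conjugate (Dodson's weight of `f` over the quadratic subfield, signed).
[cite: Dodson1984, §3.1.1 Theorem] [cite: Kubota1965, §4 Lemma 2] [cite: MontgomeryVaughan2007, §4.2 Lemma 4.2 (p. 115)] -/
theorem forall_odd_iff_forall_quadratic (hexp : ∀ g : K ≃ₐ[ℚ] K, g ^ 2 = 1) (φ₀ : K →+* ℂ) (Φ : CMType K)
    (P : ℂ → Prop) :
    (∀ χ : AddChar (Additive (K ≃ₐ[ℚ] K)) ℂ, χ (Additive.ofMul (conjGal : K ≃ₐ[ℚ] K)) = -1 →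
        P (∑ s ∈ (Finset.univ.filter fun s : K ≃ₐ[ℚ] K => embOf φ₀ s ∈ Φ.1), χ (Additive.ofMul s))) ↔
      ∀ F : IntermediateField ℚ K, finrank ℚ F = 2 → ¬ IsTotallyReal F →
        P (({φ : K →+* ℂ | φ.comp (algebraMap F K) = φ₀.comp (algebraMap F K) ∧ φ ∈ Φ.1}.ncard : ℂ) -
          ({φ : K →+* ℂ | φ.comp (algebraMap F K) = ComplexEmbedding.conjugate (φ₀.comp (algebraMap F K)) ∧
            φ ∈ Φ.1}.ncard : ℂ)) := by
  haveI := Multiquadratic.isAbelianGalois_of_forall_sq_eq_one hexp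
  rw [forall_odd_iff_forall_indexTwo hexp _ P]
  constructor
  · intro h F h2 hF
    rw [← card_filter_mem_fixingSubgroup_eq_ncard φ₀ Φ F,
      ← card_filter_not_mem_fixingSubgroup_eq_ncard hexp φ₀ Φ F h2 hF]
    exact h F.fixingSubgroup ((conjGal_not_mem_fixingSubgroup_iff F).2 hF) (index_fixingSubgroup_eq_two F h2)
  · intro h H hρH hidx
    have h2 : finrank ℚ (fixedField H) = 2 := by rw [← index_eq_finrank_fixedField H, hidx]
    have hF : ¬ IsTotallyReal (fixedField H) := (conjGal_not_mem_iff_not_isTotallyReal_fixedField H).1 hρH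
    have h' := h (fixedField H) h2 hF
    rw [← card_filter_mem_fixingSubgroup_eq_ncard φ₀ Φ (fixedField H),
      ← card_filter_not_mem_fixingSubgroup_eq_ncard hexp φ₀ Φ (fixedField H) h2 hF, fixingSubgroup_fixedField] at h'
    exact h'

end Field

/-! ## §3 Bent, near-bent and plateaued CM types read on the imaginary quadratic subfields -/

section Spectra

variable {K : Type} [Field K] [NumberField K] [IsCMField K] [IsGalois ℚ K]

/-- Bookkeeping: a symmetric condition on `2m_τ − g` for both embeddings `τ` of `F` is the condition on
`m_{φ₀|F} − m_{φ̄₀|F}`. [folklore] -/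
private theorem forall_emb_iff_wq (hexp : ∀ g : K ≃ₐ[ℚ] K, g ^ 2 = 1) (φ₀ : K →+* ℂ) (Φ : CMType K)
    (F : IntermediateField ℚ K) (h2 : finrank ℚ F = 2) (hF : ¬ IsTotallyReal F) (Q : ℤ → Prop)
    (hQ : ∀ z : ℤ, Q (-z) ↔ Q z) :
    (∀ τ : F →+* ℂ, Q (2 * ({φ : K →+* ℂ | φ.comp (algebraMap F K) = τ ∧ φ ∈ Φ.1}.ncard : ℤ) - (finrank ℚ K / 2 : ℕ))) ↔
      Q (({φ : K →+* ℂ | φ.comp (algebraMap F K) = φ₀.comp (algebraMap F K) ∧ φ ∈ Φ.1}.ncard : ℤ) -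
        ({φ : K →+* ℂ | φ.comp (algebraMap F K) = ComplexEmbedding.conjugate (φ₀.comp (algebraMap F K)) ∧
          φ ∈ Φ.1}.ncard : ℤ)) := by
  have hsum := ncard_add_ncard_conjugate_eq hexp φ₀ Φ F h2 hF
  set a := {φ : K →+* ℂ | φ.comp (algebraMap F K) = φ₀.comp (algebraMap F K) ∧ φ ∈ Φ.1}.ncard with ha
  set b := {φ : K →+* ℂ | φ.comp (algebraMap F K) = ComplexEmbedding.conjugate (φ₀.comp (algebraMap F K)) ∧
    φ ∈ Φ.1}.ncard with hb
  have hτ₀ : (2 * (a : ℤ) - (finrank ℚ K / 2 : ℕ)) = (a : ℤ) - b := by rw [← hsum]; push_cast; ring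
  have hτ₁ : (2 * (b : ℤ) - (finrank ℚ K / 2 : ℕ)) = -((a : ℤ) - b) := by rw [← hsum]; push_cast; ring
  constructor
  · intro h
    have := h (φ₀.comp (algebraMap F K))
    rwa [← ha, hτ₀] at this
  · intro h τ
    rcases eq_or_eq_conjugate_wq hexp φ₀ F h2 hF τ with rfl | rfl
    · rw [← ha, hτ₀]; exact h
    · rw [← hb, hτ₁, hQ]; exact h

/-- Cast bookkeeping `ℂ ← ℤ`. [folklore] -/
private theorem sub_cast_wq (a b : ℕ) : ((a : ℂ) - (b : ℂ)) = (((a : ℤ) - (b : ℤ) : ℤ) : ℂ) := by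
  rw [Int.cast_sub, Int.cast_natCast, Int.cast_natCast]

/-- Cast bookkeeping: `(a − b)² = L` read in `ℂ` or in `ℤ`. [folklore] -/
private theorem bridge_sq_wq (a b L : ℕ) :
    ((a : ℂ) - (b : ℂ)) ^ 2 = (L : ℂ) ↔ ((a : ℤ) - (b : ℤ)) ^ 2 = (L : ℤ) := by
  rw [sub_cast_wq a b, ← Int.cast_pow, ← Int.cast_natCast (R := ℂ) L, Int.cast_inj]

/-- Cast bookkeeping: `a − b = 0 ∨ (a − b)² = L` read in `ℂ` or in `ℤ`. [folklore] -/
private theorem bridge_or_wq (a b L : ℕ) :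
    (((a : ℂ) - (b : ℂ)) = 0 ∨ ((a : ℂ) - (b : ℂ)) ^ 2 = (L : ℂ)) ↔
      (((a : ℤ) - (b : ℤ)) = 0 ∨ ((a : ℤ) - (b : ℤ)) ^ 2 = (L : ℤ)) := by
  rw [sub_cast_wq a b, Int.cast_eq_zero, ← Int.cast_pow, ← Int.cast_natCast (R := ℂ) L, Int.cast_inj]

/-- Cast bookkeeping: `a − b = 0 ∨ (a − b)² = 2L` read in `ℂ` or in `ℤ`. [folklore] -/
private theorem bridge_or_two_mul_wq (a b L : ℕ) :
    (((a : ℂ) - (b : ℂ)) = 0 ∨ ((a : ℂ) - (b : ℂ)) ^ 2 = 2 * (L : ℂ)) ↔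
      (((a : ℤ) - (b : ℤ)) = 0 ∨ ((a : ℤ) - (b : ℤ)) ^ 2 = 2 * (L : ℤ)) := by
  have e2 : (2 : ℂ) * (L : ℂ) = ((2 * (L : ℤ) : ℤ) : ℂ) := by rw [Int.cast_mul, Int.cast_ofNat, Int.cast_natCast]
  rw [sub_cast_wq a b, Int.cast_eq_zero, ← Int.cast_pow, e2, Int.cast_inj]

/-- **BENT READ ON THE IMAGINARY QUADRATIC SUBFIELDS.**  A CM type `Φ` of a multiquadratic CM field of degree `2g` is
BENT (`Ŝ_Φ(χ)² = g` for every odd `χ`) **iff `(2m_τ(Φ) − g)² = g` for every imaginary quadratic subfield `F ⊆ K` and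
every embedding `τ : F → ℂ`**, i.e. over every imaginary quadratic subfield `Φ` has weights `((g ± √g)/2, (g ∓ √g)/2)`
(base-embedding-free). [cite: Carlet2020, §6.1.2] [cite: Dodson1984, §3.1.1 Theorem] [cite: Kubota1965, §4 Lemma 2] -/
theorem forall_sq_eq_iff_forall_quadratic (hexp : ∀ g : K ≃ₐ[ℚ] K, g ^ 2 = 1) (φ₀ : K →+* ℂ) (Φ : CMType K) :
    (∀ χ : AddChar (Additive (K ≃ₐ[ℚ] K)) ℂ, χ (Additive.ofMul (conjGal : K ≃ₐ[ℚ] K)) = -1 →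
        (∑ s ∈ (Finset.univ.filter fun s : K ≃ₐ[ℚ] K => embOf φ₀ s ∈ Φ.1), χ (Additive.ofMul s)) ^ 2 =
          ((Finset.univ.filter fun s : K ≃ₐ[ℚ] K => embOf φ₀ s ∈ Φ.1).card : ℂ)) ↔
      ∀ F : IntermediateField ℚ K, finrank ℚ F = 2 → ¬ IsTotallyReal F → ∀ τ : F →+* ℂ,
        (2 * ({φ : K →+* ℂ | φ.comp (algebraMap F K) = τ ∧ φ ∈ Φ.1}.ncard : ℤ) - (finrank ℚ K / 2 : ℕ)) ^ 2 =
          (finrank ℚ K / 2 : ℕ) := by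
  rw [card_T_eq_wq φ₀ Φ, forall_odd_iff_forall_quadratic hexp φ₀ Φ (fun z => z ^ 2 = ((finrank ℚ K / 2 : ℕ) : ℂ))]
  refine forall_congr' fun F => forall_congr' fun h2 => forall_congr' fun hF => ?_
  rw [forall_emb_iff_wq hexp φ₀ Φ F h2 hF (fun z => z ^ 2 = ((finrank ℚ K / 2 : ℕ) : ℤ)) (fun z => by rw [neg_sq])]
  exact bridge_sq_wq _ _ _

/-- **NEAR-BENT READ ON THE IMAGINARY QUADRATIC SUBFIELDS**: `Φ` is near-bent (`Ŝ_Φ(χ) = 0` or `Ŝ_Φ(χ)² = 2g` for every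
odd `χ`) **iff over every imaginary quadratic subfield `F` and every `τ : F → ℂ`, `2m_τ(Φ) = g` or `(2m_τ(Φ) − g)² = 2g`.**
[cite: Carlet2020, §6.2.4] [cite: Dodson1984, §3.1.1 Theorem] [cite: Kubota1965, §4 Lemma 2] -/
theorem nearBent_iff_forall_quadratic (hexp : ∀ g : K ≃ₐ[ℚ] K, g ^ 2 = 1) (φ₀ : K →+* ℂ) (Φ : CMType K) :
    (∀ χ : AddChar (Additive (K ≃ₐ[ℚ] K)) ℂ, χ (Additive.ofMul (conjGal : K ≃ₐ[ℚ] K)) = -1 →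
        ∑ s ∈ (Finset.univ.filter fun s : K ≃ₐ[ℚ] K => embOf φ₀ s ∈ Φ.1), χ (Additive.ofMul s) = 0 ∨
          (∑ s ∈ (Finset.univ.filter fun s : K ≃ₐ[ℚ] K => embOf φ₀ s ∈ Φ.1), χ (Additive.ofMul s)) ^ 2 =
            2 * ((Finset.univ.filter fun s : K ≃ₐ[ℚ] K => embOf φ₀ s ∈ Φ.1).card : ℂ)) ↔
      ∀ F : IntermediateField ℚ K, finrank ℚ F = 2 → ¬ IsTotallyReal F → ∀ τ : F →+* ℂ,
        (2 * ({φ : K →+* ℂ | φ.comp (algebraMap F K) = τ ∧ φ ∈ Φ.1}.ncard : ℤ) - (finrank ℚ K / 2 : ℕ)) = 0 ∨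
          (2 * ({φ : K →+* ℂ | φ.comp (algebraMap F K) = τ ∧ φ ∈ Φ.1}.ncard : ℤ) - (finrank ℚ K / 2 : ℕ)) ^ 2 =
            2 * (finrank ℚ K / 2 : ℕ) := by
  rw [card_T_eq_wq φ₀ Φ, forall_odd_iff_forall_quadratic hexp φ₀ Φ
    (fun z => z = 0 ∨ z ^ 2 = 2 * ((finrank ℚ K / 2 : ℕ) : ℂ))]
  refine forall_congr' fun F => forall_congr' fun h2 => forall_congr' fun hF => ?_
  rw [forall_emb_iff_wq hexp φ₀ Φ F h2 hF (fun z => z = 0 ∨ z ^ 2 = 2 * ((finrank ℚ K / 2 : ℕ) : ℤ))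
    (fun z => by rw [neg_sq, neg_eq_zero])]
  exact bridge_or_two_mul_wq _ _ _

/-- **PLATEAUED READ ON THE IMAGINARY QUADRATIC SUBFIELDS**: `Φ` is plateaued of squared amplitude `L`
(`Ŝ_Φ(χ) ∈ {0, ±√L}`) **iff over every imaginary quadratic subfield, `2m_τ(Φ) = g` or `(2m_τ(Φ) − g)² = L`.**
[cite: Carlet2020, §6.2.1 Definition 63] [cite: Dodson1984, §3.1.1 Theorem] [cite: Kubota1965, §4 Lemma 2] -/
theorem plateaued_iff_forall_quadratic (hexp : ∀ g : K ≃ₐ[ℚ] K, g ^ 2 = 1) (φ₀ : K →+* ℂ) (Φ : CMType K) (L : ℕ) :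
    (∀ χ : AddChar (Additive (K ≃ₐ[ℚ] K)) ℂ, χ (Additive.ofMul (conjGal : K ≃ₐ[ℚ] K)) = -1 →
        ∑ s ∈ (Finset.univ.filter fun s : K ≃ₐ[ℚ] K => embOf φ₀ s ∈ Φ.1), χ (Additive.ofMul s) = 0 ∨
          (∑ s ∈ (Finset.univ.filter fun s : K ≃ₐ[ℚ] K => embOf φ₀ s ∈ Φ.1), χ (Additive.ofMul s)) ^ 2 = (L : ℂ)) ↔
      ∀ F : IntermediateField ℚ K, finrank ℚ F = 2 → ¬ IsTotallyReal F → ∀ τ : F →+* ℂ,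
        (2 * ({φ : K →+* ℂ | φ.comp (algebraMap F K) = τ ∧ φ ∈ Φ.1}.ncard : ℤ) - (finrank ℚ K / 2 : ℕ)) = 0 ∨
          (2 * ({φ : K →+* ℂ | φ.comp (algebraMap F K) = τ ∧ φ ∈ Φ.1}.ncard : ℤ) - (finrank ℚ K / 2 : ℕ)) ^ 2 = L := by
  rw [forall_odd_iff_forall_quadratic hexp φ₀ Φ (fun z => z = 0 ∨ z ^ 2 = (L : ℂ))]
  refine forall_congr' fun F => forall_congr' fun h2 => forall_congr' fun hF => ?_
  rw [forall_emb_iff_wq hexp φ₀ Φ F h2 hF (fun z => z = 0 ∨ z ^ 2 = (L : ℤ)) (fun z => by rw [neg_sq, neg_eq_zero])]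
  exact bridge_or_wq _ _ _

end Spectra

/-! ## §4 Degrees `16`, `32`, `64`: the admissible weights -/

section Degrees

variable {K : Type} [Field K] [NumberField K] [IsCMField K] [IsGalois ℚ K]

/-- Arithmetic: `(2m − 16)² = 16 ⟺ m ∈ {6, 10}` (`m ≤ 16`). [folklore] -/
private theorem sq_eq_sixteen_iff_wq {m : ℕ} (hm : m ≤ 16) : (2 * (m : ℤ) - 16) ^ 2 = 16 ↔ m = 6 ∨ m = 10 := by
  constructor
  · intro h
    have h' : (2 * (m : ℤ) - 16 - 4) * (2 * (m : ℤ) - 16 + 4) = 0 := by nlinarith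
    rcases mul_eq_zero.1 h' with h1 | h1 <;> omega
  · rintro (rfl | rfl) <;> norm_num

/-- Arithmetic: `2m − 32 = 0 ∨ (2m − 32)² = 64 ⟺ m ∈ {12, 16, 20}`. [folklore] -/
private theorem nearBent_arith_sixtyFour_wq (m : ℕ) :
    (2 * (m : ℤ) - 32 = 0 ∨ (2 * (m : ℤ) - 32) ^ 2 = 2 * 32) ↔ m = 12 ∨ m = 16 ∨ m = 20 := by
  constructor
  · rintro (h | h)
    · omega
    · have h' : (2 * (m : ℤ) - 32 - 8) * (2 * (m : ℤ) - 32 + 8) = 0 := by nlinarith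
      rcases mul_eq_zero.1 h' with h1 | h1 <;> omega
  · rintro (rfl | rfl | rfl) <;> norm_num

/-- Arithmetic: `2m − 8 = 0 ∨ (2m − 8)² = 16 ⟺ m ∈ {2, 4, 6}`. [folklore] -/
private theorem nearBent_arith_sixteen_wq (m : ℕ) :
    (2 * (m : ℤ) - 8 = 0 ∨ (2 * (m : ℤ) - 8) ^ 2 = 2 * 8) ↔ m = 2 ∨ m = 4 ∨ m = 6 := by
  constructor
  · rintro (h | h)
    · omega
    · have h' : (2 * (m : ℤ) - 8 - 4) * (2 * (m : ℤ) - 8 + 4) = 0 := by nlinarith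
      rcases mul_eq_zero.1 h' with h1 | h1 <;> omega
  · rintro (rfl | rfl | rfl) <;> norm_num

omit [IsCMField K] [IsGalois ℚ K] in
/-- A multiplicity is at most `[K:ℚ]/2`: `m_τ(Φ) ≤ |Φ| = g`. [folklore] -/
private theorem ncard_le_wq (Φ : CMType K) (F : IntermediateField ℚ K) (τ : F →+* ℂ) :
    {φ : K →+* ℂ | φ.comp (algebraMap F K) = τ ∧ φ ∈ Φ.1}.ncard ≤ finrank ℚ K / 2 := by
  have h := Literature.AlgebraicGeometry.Motives.HodgeStructure.two_mul_ncard_cmType_eq_finrank Φ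
  have hsub : {φ : K →+* ℂ | φ.comp (algebraMap F K) = τ ∧ φ ∈ Φ.1} ⊆ Φ.1 := fun φ hφ => hφ.2
  have := Set.ncard_le_ncard hsub (Set.toFinite _)
  omega

/-- **DEGREE `32` (`g = 16`): `Φ` IS BENT IFF OVER EACH OF ITS IMAGINARY QUADRATIC SUBFIELDS IT HAS WEIGHTS `(6, 10)` OR
`(10, 6)`** — the `896` bent CM types of a multiquadratic CM field of degree `32` are those whose multiplicity over
every imaginary quadratic subfield (there are `16`) is `6` or `10` (the tree's group-level `a_χ ∈ {6, 10}`,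
`typeRank_eq_seventeen_iff_forall_of_even`, made intrinsic). [cite: Carlet2020, §6.1.2] [cite: Dodson1984, §3.1.1 Theorem]
[cite: Tokareva2015BentFunctions, §7.1] -/
theorem forall_sq_eq_iff_of_finrank_eq_thirtyTwo (hexp : ∀ g : K ≃ₐ[ℚ] K, g ^ 2 = 1) (φ₀ : K →+* ℂ) (Φ : CMType K)
    (hK : finrank ℚ K = 32) :
    (∀ χ : AddChar (Additive (K ≃ₐ[ℚ] K)) ℂ, χ (Additive.ofMul (conjGal : K ≃ₐ[ℚ] K)) = -1 →
        (∑ s ∈ (Finset.univ.filter fun s : K ≃ₐ[ℚ] K => embOf φ₀ s ∈ Φ.1), χ (Additive.ofMul s)) ^ 2 =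
          ((Finset.univ.filter fun s : K ≃ₐ[ℚ] K => embOf φ₀ s ∈ Φ.1).card : ℂ)) ↔
      ∀ F : IntermediateField ℚ K, finrank ℚ F = 2 → ¬ IsTotallyReal F → ∀ τ : F →+* ℂ,
        {φ : K →+* ℂ | φ.comp (algebraMap F K) = τ ∧ φ ∈ Φ.1}.ncard = 6 ∨
          {φ : K →+* ℂ | φ.comp (algebraMap F K) = τ ∧ φ ∈ Φ.1}.ncard = 10 := by
  rw [forall_sq_eq_iff_forall_quadratic hexp φ₀ Φ]
  have hg : finrank ℚ K / 2 = 16 := by rw [hK]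
  refine forall_congr' fun F => forall_congr' fun h2 => forall_congr' fun hF => forall_congr' fun τ => ?_
  rw [hg]
  push_cast
  exact sq_eq_sixteen_iff_wq (by have := ncard_le_wq Φ F τ; rw [hg] at this; exact this)

/-- **DEGREE `64` (`g = 32`): `Φ` IS NEAR-BENT IFF OVER EACH OF ITS `32` IMAGINARY QUADRATIC SUBFIELDS IT HAS
WEIGHTS `(12, 20)`, `(16, 16)` OR `(20, 12)`.** [cite: Carlet2020, §6.2.4] [cite: Dodson1984, §3.1.1 Theorem]
[cite: Kubota1965, §4 Lemma 2] -/
theorem nearBent_iff_of_finrank_eq_sixtyFour (hexp : ∀ g : K ≃ₐ[ℚ] K, g ^ 2 = 1) (φ₀ : K →+* ℂ) (Φ : CMType K)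
    (hK : finrank ℚ K = 64) :
    (∀ χ : AddChar (Additive (K ≃ₐ[ℚ] K)) ℂ, χ (Additive.ofMul (conjGal : K ≃ₐ[ℚ] K)) = -1 →
        ∑ s ∈ (Finset.univ.filter fun s : K ≃ₐ[ℚ] K => embOf φ₀ s ∈ Φ.1), χ (Additive.ofMul s) = 0 ∨
          (∑ s ∈ (Finset.univ.filter fun s : K ≃ₐ[ℚ] K => embOf φ₀ s ∈ Φ.1), χ (Additive.ofMul s)) ^ 2 =
            2 * ((Finset.univ.filter fun s : K ≃ₐ[ℚ] K => embOf φ₀ s ∈ Φ.1).card : ℂ)) ↔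
      ∀ F : IntermediateField ℚ K, finrank ℚ F = 2 → ¬ IsTotallyReal F → ∀ τ : F →+* ℂ,
        {φ : K →+* ℂ | φ.comp (algebraMap F K) = τ ∧ φ ∈ Φ.1}.ncard = 12 ∨
          {φ : K →+* ℂ | φ.comp (algebraMap F K) = τ ∧ φ ∈ Φ.1}.ncard = 16 ∨
          {φ : K →+* ℂ | φ.comp (algebraMap F K) = τ ∧ φ ∈ Φ.1}.ncard = 20 := by
  rw [nearBent_iff_forall_quadratic hexp φ₀ Φ]
  have hg : finrank ℚ K / 2 = 32 := by rw [hK]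
  refine forall_congr' fun F => forall_congr' fun h2 => forall_congr' fun hF => forall_congr' fun τ => ?_
  rw [hg]
  push_cast
  exact nearBent_arith_sixtyFour_wq _

/-- **DEGREE `16` (`g = 8`): `Φ` IS NEAR-BENT IFF OVER EACH OF ITS `8` IMAGINARY QUADRATIC SUBFIELDS IT HAS WEIGHTS
`(2, 6)`, `(4, 4)` OR `(6, 2)`** (these are the `112` CM types of rank `5`, tree `nearBent_iff_cmTypeRank_eq_five_of_finrank_eq_sixteen`).
[cite: Carlet2020, §6.2.4] [cite: Dodson1984, §3.1.1 Theorem] [cite: Kubota1965, §4 Lemma 2] -/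
theorem nearBent_iff_of_finrank_eq_sixteen (hexp : ∀ g : K ≃ₐ[ℚ] K, g ^ 2 = 1) (φ₀ : K →+* ℂ) (Φ : CMType K)
    (hK : finrank ℚ K = 16) :
    (∀ χ : AddChar (Additive (K ≃ₐ[ℚ] K)) ℂ, χ (Additive.ofMul (conjGal : K ≃ₐ[ℚ] K)) = -1 →
        ∑ s ∈ (Finset.univ.filter fun s : K ≃ₐ[ℚ] K => embOf φ₀ s ∈ Φ.1), χ (Additive.ofMul s) = 0 ∨
          (∑ s ∈ (Finset.univ.filter fun s : K ≃ₐ[ℚ] K => embOf φ₀ s ∈ Φ.1), χ (Additive.ofMul s)) ^ 2 =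
            2 * ((Finset.univ.filter fun s : K ≃ₐ[ℚ] K => embOf φ₀ s ∈ Φ.1).card : ℂ)) ↔
      ∀ F : IntermediateField ℚ K, finrank ℚ F = 2 → ¬ IsTotallyReal F → ∀ τ : F →+* ℂ,
        {φ : K →+* ℂ | φ.comp (algebraMap F K) = τ ∧ φ ∈ Φ.1}.ncard = 2 ∨
          {φ : K →+* ℂ | φ.comp (algebraMap F K) = τ ∧ φ ∈ Φ.1}.ncard = 4 ∨
          {φ : K →+* ℂ | φ.comp (algebraMap F K) = τ ∧ φ ∈ Φ.1}.ncard = 6 := by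
  rw [nearBent_iff_forall_quadratic hexp φ₀ Φ]
  have hg : finrank ℚ K / 2 = 8 := by rw [hK]
  refine forall_congr' fun F => forall_congr' fun h2 => forall_congr' fun hF => forall_congr' fun τ => ?_
  rw [hg]
  push_cast
  exact nearBent_arith_sixteen_wq _

end Degrees

end MultiquadraticWalshQuadratic

end Literature.AlgebraicGeometry.Pohlmann1968
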